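import Summits.ValiantsHypothesis.ValiantsHypothesis.Theorems.GrenetZeonDualUnipotentThreeHalvesHeavyTopTowerDefs

/-!
# `GrenetZeon.DualUnipotentThreeHalves` (stmt-ValiantsHypothesis-24318), R2 heavy-top instrument — the TOWER HULL `T(p, I, q)`:
# the DIMENSION COUNT `dim T(p, I, q) = C(p+3+q, 2) − 3 + dim I` (val-idea-30 MEMO codim-one COROLLARY II, small lemmas; director R504-htc (2)(b))

The tower hull `towerHull p q I` (✓ `…HeavyTopTowerDefs`) is, as a linear space, the product of the free positions — the positions `(i, j)`,
`i < j`, NOT inside the middle `3 × 3` block; there are `C(p+3+q, 2) − 3` of them — and the middle block `I ≤ M₃(ℂ)`.  Hence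
`dim T(p, I, q) + 3 = C(p+3+q, 2) + dim I`, i.e. `dim T(p, I, q) = C(m, 2) − 1` exactly when `dim I = 2` (`m = p + 3 + q`): the towers over an
irreducible nilpotent PLANE of `M₃(ℂ)` are the codimension-one configurations of COROLLARY II (with ✓ `…HeavyTopTowerLemmas`: nilpotent, not
triangularisable).

* `blk_le_blk`, `blk_eq_one_iff`, `lt_of_blk_lt` — arithmetic of the block index `blk`;
* `midBlock_fill`, `fill_mem_towerHull`, `fill_eq_of_mem_towerHull`, `eq_zero_of_mem_towerHull` — the filling chart (the matrix with prescribed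
  free entries and middle block, written as an explicit `Matrix.of`; no definition) and the vanishing of hull members off the free / middle positions;
* `card_freePos` — the free positions number `C(p+3+q, 2) − 3`;
* ★ `finrank_towerHull_add_three : finrank (towerHull p q I) + 3 = C(p+3+q, 2) + finrank I` (via the linear chart hull `≃ₗ` free × `I`),
  `finrank_towerHull_of_finrank_eq_two : finrank I = 2 → finrank (towerHull p q I) = C(p+3+q, 2) − 1`.

Honest framing: a dimension count; nothing here proves or refutes `HeavyTopLaw`, 24318, S3b or 8062; `VP ≠ VNP` is NOT proved.  No definitions.
[val-idea-30 MEMO codim-one §4 (ii); cell val-heavytop-census, eng-1 g5]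
-/

noncomputable section

-- single-conjunct layout: Sub = Summit, duplicated namespace component intended
set_option linter.dupNamespace false

namespace Summit.ValiantsHypothesis.ValiantsHypothesis.Theorems.GrenetZeon.HeavyTopTowerDimension

open Matrix
open Summit.ValiantsHypothesis.ValiantsHypothesis.Theorems.GrenetZeon.HeavyTopTowerDefs

/-! ## Arithmetic of the block index -/

/-- `blk` is monotone. -/
theorem blk_le_blk (p : ℕ) {i j : ℕ} (h : i ≤ j) : blk p i ≤ blk p j := by
  simp only [blk]; split_ifs <;> omega

/-- `blk p i = 1` exactly on the middle window `[p, p+3)`. -/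
theorem blk_eq_one_iff (p i : ℕ) : blk p i = 1 ↔ p ≤ i ∧ i < p + 3 := by
  unfold blk; split_ifs with h1 h2
  · exact ⟨fun h => absurd h (by decide), fun h => absurd h.1 (not_le.2 h1)⟩
  · exact ⟨fun _ => ⟨not_lt.1 h1, h2⟩, fun _ => rfl⟩
  · exact ⟨fun h => absurd h (by decide), fun h => absurd h.2 h2⟩

/-- A strict inequality of block indices forces a strict inequality of indices. -/
theorem lt_of_blk_lt (p : ℕ) {i j : ℕ} (h : blk p i < blk p j) : i < j := by
  by_contra hij
  exact absurd (blk_le_blk p (not_lt.1 hij)) (not_le.2 h)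

/-! ## The filling chart (free entries `f`, middle block `X`, zero elsewhere) — stated about the explicit `Matrix.of` expression, no definition -/

/-- The middle block of the filling with free entries `f` and middle block `X` is `X`. -/
theorem midBlock_fill (p q : ℕ) (f : {x : Fin (p + 3 + q) × Fin (p + 3 + q) // x.1 < x.2 ∧ ¬ (blk p x.1 = 1 ∧ blk p x.2 = 1)} → ℂ)
    (X : Matrix (Fin 3) (Fin 3) ℂ) :
    midBlock p q (Matrix.of fun i j : Fin (p + 3 + q) =>
      if h : i < j ∧ ¬ (blk p i = 1 ∧ blk p j = 1) then f ⟨(i, j), h⟩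
      else if h' : blk p i = 1 ∧ blk p j = 1 then
        X ⟨(i : ℕ) - p, by have := (blk_eq_one_iff p i).1 h'.1; omega⟩ ⟨(j : ℕ) - p, by have := (blk_eq_one_iff p j).1 h'.2; omega⟩
      else 0) = X := by
  ext a b
  have ha : blk p (p + (a : ℕ)) = 1 := (blk_eq_one_iff p _).2 ⟨by omega, by omega⟩
  have hb : blk p (p + (b : ℕ)) = 1 := (blk_eq_one_iff p _).2 ⟨by omega, by omega⟩
  rw [midBlock_apply, Matrix.of_apply, dif_neg (fun h => h.2 ⟨ha, hb⟩), dif_pos ⟨ha, hb⟩]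
  congr 1 <;> apply Fin.ext <;> simp

/-- The filling lies in the tower hull as soon as its middle block lies in `I`. -/
theorem fill_mem_towerHull {p q : ℕ} (I : Submodule ℂ (Matrix (Fin 3) (Fin 3) ℂ))
    (f : {x : Fin (p + 3 + q) × Fin (p + 3 + q) // x.1 < x.2 ∧ ¬ (blk p x.1 = 1 ∧ blk p x.2 = 1)} → ℂ) (X : Matrix (Fin 3) (Fin 3) ℂ)
    (hX : X ∈ I) :
    (Matrix.of fun i j : Fin (p + 3 + q) =>
      if h : i < j ∧ ¬ (blk p i = 1 ∧ blk p j = 1) then f ⟨(i, j), h⟩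
      else if h' : blk p i = 1 ∧ blk p j = 1 then
        X ⟨(i : ℕ) - p, by have := (blk_eq_one_iff p i).1 h'.1; omega⟩ ⟨(j : ℕ) - p, by have := (blk_eq_one_iff p j).1 h'.2; omega⟩
      else 0) ∈ towerHull p q I := by
  refine mem_towerHull.2 ⟨⟨fun i j hij => ?_, fun i j hij h1 hji => ?_⟩, ?_⟩
  · have hlt : (j : ℕ) < i := lt_of_blk_lt p hij
    rw [Matrix.of_apply, dif_neg (fun h => absurd (Fin.lt_def.1 h.1) (by omega)), dif_neg (fun h => by omega)]
  · rw [Matrix.of_apply, dif_neg (fun h => absurd (Fin.lt_def.1 h.1) (by omega)), dif_neg (fun h => h1 h.1)]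
  · rw [midBlock_fill]; exact hX

/-- A member of the tower hull vanishes at every position that is neither free nor in the middle block. -/
theorem eq_zero_of_mem_towerHull {p q : ℕ} {I : Submodule ℂ (Matrix (Fin 3) (Fin 3) ℂ)} {A : Matrix (Fin (p + 3 + q)) (Fin (p + 3 + q)) ℂ}
    (hA : A ∈ towerHull p q I) (i j : Fin (p + 3 + q)) (hfree : ¬ (i < j ∧ ¬ (blk p i = 1 ∧ blk p j = 1)))
    (hmid : ¬ (blk p i = 1 ∧ blk p j = 1)) : A i j = 0 := by
  obtain ⟨⟨h1, h2⟩, -⟩ := mem_towerHull.1 hA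
  have hji : (j : ℕ) ≤ i := by
    by_contra h
    exact hfree ⟨Fin.lt_def.2 (by omega), hmid⟩
  rcases lt_or_ge (blk p j) (blk p i) with hlt | hge
  · exact h1 i j hlt
  · have heq : blk p i = blk p j := le_antisymm hge (blk_le_blk p hji)
    exact h2 i j heq (fun h => hmid ⟨h, heq ▸ h⟩) hji

/-- A member of the tower hull IS the filling of its free entries and its middle block. -/
theorem fill_eq_of_mem_towerHull {p q : ℕ} {I : Submodule ℂ (Matrix (Fin 3) (Fin 3) ℂ)} {A : Matrix (Fin (p + 3 + q)) (Fin (p + 3 + q)) ℂ}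
    (hA : A ∈ towerHull p q I) :
    (fun (f : {x : Fin (p + 3 + q) × Fin (p + 3 + q) // x.1 < x.2 ∧ ¬ (blk p x.1 = 1 ∧ blk p x.2 = 1)} → ℂ) (X : Matrix (Fin 3) (Fin 3) ℂ) =>
      (Matrix.of fun i j : Fin (p + 3 + q) =>
        if h : i < j ∧ ¬ (blk p i = 1 ∧ blk p j = 1) then f ⟨(i, j), h⟩
        else if h' : blk p i = 1 ∧ blk p j = 1 then
          X ⟨(i : ℕ) - p, by have := (blk_eq_one_iff p i).1 h'.1; omega⟩ ⟨(j : ℕ) - p, by have := (blk_eq_one_iff p j).1 h'.2; omega⟩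
        else 0)) (fun x => A x.1.1 x.1.2) (midBlock p q A) = A := by
  ext i j
  dsimp only
  rw [Matrix.of_apply]
  by_cases hfree : i < j ∧ ¬ (blk p i = 1 ∧ blk p j = 1)
  · rw [dif_pos hfree]
  · rw [dif_neg hfree]
    by_cases hmid : blk p i = 1 ∧ blk p j = 1
    · rw [dif_pos hmid, midBlock_apply]
      have hi := (blk_eq_one_iff p i).1 hmid.1
      have hj := (blk_eq_one_iff p j).1 hmid.2
      congr 1 <;> apply Fin.ext <;> dsimp only <;> omega
    · rw [dif_neg hmid, eq_zero_of_mem_towerHull hA i j hfree hmid]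

/-! ## Counting the free positions -/

/-- The number of free positions: `#freePos + 3 = C(p+3+q, 2)` (all `C(m,2)` positions above the diagonal except the `3` inside the middle block).
(The count of the positions above the diagonal is adapted from ✓ `Literature…GerstenhaberNilpotentSubspaceEquality`, §`dim NT_n`.) -/
theorem card_freePos (p q : ℕ) :
    Fintype.card {x : Fin (p + 3 + q) × Fin (p + 3 + q) // x.1 < x.2 ∧ ¬ (blk p x.1 = 1 ∧ blk p x.2 = 1)} + 3 = (p + 3 + q).choose 2 := by
  -- positions above the diagonal
  have hlt : (Finset.univ.filter fun x : Fin (p + 3 + q) × Fin (p + 3 + q) => x.1 < x.2).card = (p + 3 + q).choose 2 := by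
    have hle : Fintype.card {x : Fin (p + 3 + q) × Fin (p + 3 + q) // x.1 ≤ x.2} = (p + 3 + q + 1).choose 2 := by
      rw [← Fintype.card_congr Sym2.sortEquiv, Sym2.card, Fintype.card_fin]
    rw [Fintype.card_subtype] at hle
    have hsplit : (Finset.univ.filter fun x : Fin (p + 3 + q) × Fin (p + 3 + q) => x.1 ≤ x.2) =
        (Finset.univ.filter fun x : Fin (p + 3 + q) × Fin (p + 3 + q) => x.1 < x.2) ∪
          (Finset.univ.filter fun x : Fin (p + 3 + q) × Fin (p + 3 + q) => x.1 = x.2) := by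
      rw [← Finset.filter_or]
      exact Finset.filter_congr fun x _ => le_iff_lt_or_eq
    have hdisj : Disjoint (Finset.univ.filter fun x : Fin (p + 3 + q) × Fin (p + 3 + q) => x.1 < x.2)
        (Finset.univ.filter fun x : Fin (p + 3 + q) × Fin (p + 3 + q) => x.1 = x.2) :=
      Finset.disjoint_filter.2 fun x _ h1 h2 => (ne_of_lt h1) h2
    have hdiag : (Finset.univ.filter fun x : Fin (p + 3 + q) × Fin (p + 3 + q) => x.1 = x.2).card = p + 3 + q := by
      have h : (Finset.univ.filter fun x : Fin (p + 3 + q) × Fin (p + 3 + q) => x.1 = x.2) =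
          (Finset.univ : Finset (Fin (p + 3 + q))).diag := by
        ext x
        simp [Finset.mem_diag]
      rw [h, Finset.diag_card, Finset.card_univ, Fintype.card_fin]
    have h2 : (p + 3 + q + 1).choose 2 = (p + 3 + q) + (p + 3 + q).choose 2 := by
      rw [show 2 = 1 + 1 from rfl, Nat.choose_succ_succ', Nat.choose_one_right]
    rw [hsplit, Finset.card_union_of_disjoint hdisj, hdiag, h2] at hle
    omega
  -- the three positions above the diagonal inside the middle block
  have hmid : (Finset.univ.filter fun x : Fin (p + 3 + q) × Fin (p + 3 + q) => x.1 < x.2 ∧ (blk p x.1 = 1 ∧ blk p x.2 = 1)).card = 3 := by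
    rw [Finset.card_eq_three]
    refine ⟨(⟨p, by omega⟩, ⟨p + 1, by omega⟩), (⟨p, by omega⟩, ⟨p + 2, by omega⟩), (⟨p + 1, by omega⟩, ⟨p + 2, by omega⟩), ?_, ?_, ?_, ?_⟩
    · intro h; have := congrArg (fun x => ((x.2 : Fin (p + 3 + q)) : ℕ)) h; simp at this
    · intro h; have := congrArg (fun x => ((x.1 : Fin (p + 3 + q)) : ℕ)) h; simp at this
    · intro h; have := congrArg (fun x => ((x.1 : Fin (p + 3 + q)) : ℕ)) h; simp at this
    · ext ⟨i, j⟩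
      simp only [Finset.mem_filter, Finset.mem_univ, true_and, Finset.mem_insert, Finset.mem_singleton, Prod.mk.injEq,
        Fin.ext_iff, Fin.lt_def, blk_eq_one_iff]
      omega
  -- free = above-diagonal minus middle
  have hsplit : (Finset.univ.filter fun x : Fin (p + 3 + q) × Fin (p + 3 + q) => x.1 < x.2) =
      (Finset.univ.filter fun x : Fin (p + 3 + q) × Fin (p + 3 + q) => x.1 < x.2 ∧ ¬ (blk p x.1 = 1 ∧ blk p x.2 = 1)) ∪
        (Finset.univ.filter fun x : Fin (p + 3 + q) × Fin (p + 3 + q) => x.1 < x.2 ∧ (blk p x.1 = 1 ∧ blk p x.2 = 1)) := by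
    rw [← Finset.filter_or]
    exact Finset.filter_congr fun x _ => by tauto
  have hdisj : Disjoint (Finset.univ.filter fun x : Fin (p + 3 + q) × Fin (p + 3 + q) => x.1 < x.2 ∧ ¬ (blk p x.1 = 1 ∧ blk p x.2 = 1))
      (Finset.univ.filter fun x : Fin (p + 3 + q) × Fin (p + 3 + q) => x.1 < x.2 ∧ (blk p x.1 = 1 ∧ blk p x.2 = 1)) :=
    Finset.disjoint_filter.2 fun x _ h1 h2 => h1.2 h2.2
  rw [Fintype.card_subtype, ← hlt, hsplit, Finset.card_union_of_disjoint hdisj, hmid]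

/-! ## The dimension of the tower hull -/

/-- ★ **`dim T(p, I, q) + 3 = C(p+3+q, 2) + dim I`.** [val-idea-30 MEMO codim-one §4 (ii)] -/
theorem finrank_towerHull_add_three (p q : ℕ) (I : Submodule ℂ (Matrix (Fin 3) (Fin 3) ℂ)) :
    Module.finrank ℂ (towerHull p q I) + 3 = (p + 3 + q).choose 2 + Module.finrank ℂ I := by
  -- the chart: hull ≃ (free entries) × (middle block)
  let e : towerHull p q I ≃ₗ[ℂ] ({x : Fin (p + 3 + q) × Fin (p + 3 + q) // x.1 < x.2 ∧ ¬ (blk p x.1 = 1 ∧ blk p x.2 = 1)} → ℂ) × I :=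
    { toFun := fun A => (fun x => (A : Matrix (Fin (p + 3 + q)) (Fin (p + 3 + q)) ℂ) x.1.1 x.1.2, ⟨midBlock p q A, (mem_towerHull.1 A.2).2⟩)
      invFun := fun fX => ⟨(fun (f : {x : Fin (p + 3 + q) × Fin (p + 3 + q) // x.1 < x.2 ∧ ¬ (blk p x.1 = 1 ∧ blk p x.2 = 1)} → ℂ) (X : Matrix (Fin 3) (Fin 3) ℂ) =>
          (Matrix.of fun i j : Fin (p + 3 + q) =>
          if h : i < j ∧ ¬ (blk p i = 1 ∧ blk p j = 1) then f ⟨(i, j), h⟩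
          else if h' : blk p i = 1 ∧ blk p j = 1 then
            X ⟨(i : ℕ) - p, by have := (blk_eq_one_iff p i).1 h'.1; omega⟩ ⟨(j : ℕ) - p, by have := (blk_eq_one_iff p j).1 h'.2; omega⟩
          else 0)) fX.1 fX.2, fill_mem_towerHull I fX.1 fX.2 fX.2.2⟩
      map_add' := fun A B => by ext x <;> rfl
      map_smul' := fun c A => by ext x <;> rfl
      left_inv := fun A => Subtype.ext (fill_eq_of_mem_towerHull A.2)
      right_inv := fun fX => by
        refine Prod.ext ?_ (Subtype.ext (midBlock_fill p q fX.1 fX.2))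
        funext x
        dsimp only
        rw [Matrix.of_apply, dif_pos x.2] }
  rw [e.finrank_eq, Module.finrank_prod, Module.finrank_fintype_fun_eq_card, ← card_freePos p q]
  omega

/-- ★ **Over a PLANE `I ≤ M₃(ℂ)` the tower hull has codimension one in `C(m, 2)`:** `dim T(p, I, q) = C(p+3+q, 2) − 1`
(the dimension of COROLLARY II's towers). -/
theorem finrank_towerHull_of_finrank_eq_two (p q : ℕ) (I : Submodule ℂ (Matrix (Fin 3) (Fin 3) ℂ)) (hI : Module.finrank ℂ I = 2) :
    Module.finrank ℂ (towerHull p q I) = (p + 3 + q).choose 2 - 1 := by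
  have h := finrank_towerHull_add_three p q I
  have h3 : 3 ≤ (p + 3 + q).choose 2 := by
    have := Nat.choose_le_choose 2 (show 3 ≤ p + 3 + q by omega)
    simpa using this
  omega

end Summit.ValiantsHypothesis.ValiantsHypothesis.Theorems.GrenetZeon.HeavyTopTowerDimension

end
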